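import Summits.SmoothPoincare4.SmoothPoincare4.Theorems.SymplecticOrigamiGromovRecognitionRelEndHelperNwtInnerK
import Summits.SmoothPoincare4.SmoothPoincare4.Theorems.SymplecticOrigamiGromovRecognitionRelEndHelperNwtIndexSum
import Summits.SmoothPoincare4.SmoothPoincare4.Theorems.SymplecticOrigamiGromovRecognitionRelEndHelperWVecNeZeroOfProper
import Summits.SmoothPoincare4.SmoothPoincare4.Theorems.SymplecticOrigamiGromovRecognitionRelEndHelperPlaneFieldRotation
import Summits.SmoothPoincare4.SmoothPoincare4.Theorems.SymplecticOrigamiGromovRecognitionRelEndHelperPlaneFieldSection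
import Summits.SmoothPoincare4.SmoothPoincare4.Theorems.SymplecticOrigamiGromovRecognitionRelEndHelperSectionOverDisc
import Summits.SmoothPoincare4.SmoothPoincare4.Theorems.SymplecticOrigamiGromovRecognitionRelEndHelperSphereSectionOfIndexZero
import Summits.SmoothPoincare4.SmoothPoincare4.Theorems.SymplecticOrigamiGromovRecognitionRelEndHelperTransportSection
import Mathlib.Topology.Metrizable.Urysohn

/-!
# Crossing helper for `GromovRecognitionRelEnd` (line cross-cap-laurent): the core of the transfer step

Support lemma for crux `stmt-SmoothPoincare4-11009` (child stub `stub_normalWitnessTransfer` of the split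
piece `AdjunctionEmbeddedSpheres`): Kirby's transport argument (Kirby 1989, Ch. VIII, proof of Thm. 2).
In a Whitney picture `D` of the embedded sphere `Σ = F(ℂℙ¹) = b(ℂℙ¹)` the normal plane field `ν` of `Σ`
extends to Kirby's plane field `P` over `e(X)`; the pushed-off fibre `K = G(ℂℙ¹)` of the witness sphere
(`helper_nwtInnerK`) meets `Σ` transversally in finitely many points with vanishing signed count, so the
local indices of the tautological section of `P|K` at the crossings sum to zero (`helper_nwtIndexSum`) and
`P|K` has a nowhere-zero section (`helper_sphereSectionOfIndexZero`); transporting it along the homotopy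
`K ≃ Σ` (`helper_transportSection`) gives a nowhere-zero section of `P|Σ = ν`, i.e. of the normal bundle.
-/

noncomputable section

open scoped Manifold ContDiff Topology
open Set Function Metric Literature.Topology.FourManifolds Literature.Topology.FourManifolds.ComplexProjectiveSpace
  Literature.Topology.PlaneTopology Literature.Topology.FourManifolds.NormalEuler Literature.Geometry.Symplectic

set_option linter.dupNamespace false

namespace Summit.SmoothPoincare4.SmoothPoincare4.Theorems.GromovRecognitionRelEnd.CrossCapLaurent

set_option maxHeartbeats 800000 in
/-- **Core of the transfer step (Kirby 1989, Ch. VIII, Thm. 2, transport form).** In a Whitney picture `D` of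
an embedded two-chart sphere `Σ = (u, v, F)`, `F = D.b`, proper near `Σ`, homotopic to an embedded sphere
`Σ₀ = (u₀, v₀, F₀)` carrying a trivial-normal-bundle witness `(N, π)`, the normal bundle of `Σ` has a continuous
nowhere-zero section `s₀` (`Q y (s₀ y) = s₀ y ≠ 0`). -/
theorem helper_nwtInner : ∀ (m : ℕ) (X : Type) [TopologicalSpace X] [T2Space X] [SecondCountableTopology X] [ChartedSpace (EuclideanSpace ℝ (Fin 4)) X] [IsManifold (𝓡 4) ∞ X] (o : Literature.Topology.FourManifolds.SmoothOrientation (𝓡 4) X) (D : Literature.Topology.FourManifolds.CodimTwoData 2 X (Literature.Topology.FourManifolds.ComplexProjectiveSpace 1) (EuclideanSpace ℝ (Fin m))) (η : ℝ) (u v u₀ v₀ : ℂ → X) (N : Set X) (π : X → ℂ) (F F₀ : C(Literature.Topology.FourManifolds.ComplexProjectiveSpace 1, X)), 0 < η → IsCompact {q : X | Metric.infDist (D.e q) D.img ≤ η} → (∀ θ, F θ = D.b θ) → ContMDiff 𝓘(ℝ, ℂ) (𝓡 4) ∞ u → ContMDiff 𝓘(ℝ, ℂ) (𝓡 4) ∞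 v → (∀ z : ℂ, z ≠ 0 → v z = u z⁻¹) → Function.Injective u → (∀ z, Function.Injective (mfderiv 𝓘(ℝ, ℂ) (𝓡 4) u z)) → Function.Injective (mfderiv 𝓘(ℝ, ℂ) (𝓡 4) v 0) → v 0 ∉ Set.range u → (∀ p, Literature.Topology.FourManifolds.ComplexProjectiveSpace.CoordNeZero 0 p → F p = u (Literature.Topology.FourManifolds.ComplexProjectiveSpace.affineCoordComplex 0 p 0)) → (∀ p, Literature.Topology.FourManifolds.ComplexProjectiveSpace.CoordNeZero 1 p → F p = v (Literature.Topology.FourManifolds.ComplexProjectiveSpace.affineCoordComplex 1 p 0)) → ContMDiff 𝓘(ℝ, ℂ) (𝓡 4) ∞ u₀ → ContMDiff 𝓘(ℝ, ℂ) (𝓡 4) ∞ v₀ → (∀ z : ℂ, z ≠ 0 → v₀ z = u₀ z⁻¹) → Function.Injective u₀ → (∀ z, Function.Injective (mfderiv 𝓘(ℝ, ℂ) (𝓡 4) u₀ z)) → Function.Injective (mfderiv 𝓘(ℝ, ℂ) (𝓡 4) v₀ 0) → v₀ 0 ∉ Set.range u₀ → IsOpen N → Set.range u₀ ∪ {v₀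 0} ⊆ N → ContMDiffOn (𝓡 4) 𝓘(ℝ, ℂ) ∞ π N → (∀ y ∈ N, Function.Surjective (mfderiv (𝓡 4) 𝓘(ℝ, ℂ) π y)) → {y | y ∈ N ∧ π y = 0} = Set.range u₀ ∪ {v₀ 0} → (∀ p, Literature.Topology.FourManifolds.ComplexProjectiveSpace.CoordNeZero 0 p → F₀ p = u₀ (Literature.Topology.FourManifolds.ComplexProjectiveSpace.affineCoordComplex 0 p 0)) → (∀ p, Literature.Topology.FourManifolds.ComplexProjectiveSpace.CoordNeZero 1 p → F₀ p = v₀ (Literature.Topology.FourManifolds.ComplexProjectiveSpace.affineCoordComplex 1 p 0)) → F.Homotopic F₀ → ∃ s₀ : Literature.Topology.FourManifolds.ComplexProjectiveSpace 1 → EuclideanSpace ℝ (Fin m), Continuous s₀ ∧ ∀ y, D.Q y (s₀ y) = s₀ y ∧ s₀ y ≠ 0 := by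
  intro m X _ _ _ _ _ o D η u v u₀ v₀ N π F F₀ hη hK hFb hu hv huv huinj himm hvimm hv0 hFu hFv hu₀ hv₀ huv₀ hu₀inj hu₀imm
    hv₀imm hv₀0 hN hSN hπ hπs hzero hF₀u hF₀v hFF₀
  classical
  -- K side: product chart `Φ`, level `s`, crossing parameters `ZK`/`zc`, the count, and the sphere `G = K_s ≃ F`
  obtain ⟨UK, g, Φ, s, ZK, zc, G, hUK, hg, hΦ, hΦd, hΦU, hgΦ, hzc, hreg, hcount, hGΦ, hGoff, hGF⟩ :=
    helper_nwtInnerK X u v u₀ v₀ N π F F₀ hu hv huv huinj hv0 hFu hFv hu₀ hv₀ huv₀ hu₀inj hu₀imm hv₀imm hv₀0 hN hSN hπ hπs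
      hzero hF₀u hF₀v hFF₀
  -- `Σ = b(ℂℙ¹) = u(ℂ) ∪ {v 0}`
  have hbu : ∀ z, D.b (CodimTwoData.linePt 0 z) = u z := fun z => (hFb _).symm.trans (apply_linePt_eq hFu z)
  have hrange : ∀ y, y ∈ range D.b → y ∈ range u ∪ {v 0} := by
    rintro _ ⟨θ, rfl⟩
    rcases eq_linePt_zero_or_eq_linePt_one_zero θ with ⟨z, rfl⟩ | rfl
    · exact Or.inl ⟨z, (hbu z).symm⟩
    · exact Or.inr (by rw [mem_singleton_iff, ← hFb, apply_linePt_eq hFv])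
  have himg : ∀ q : X, D.e q ∈ D.img → q ∈ range u ∪ {v 0} := fun q ⟨θ, hθ⟩ => hrange q ⟨θ, D.heinj hθ⟩
  -- radii, Kirby's plane field `P`, its rotation `Rot` and tautological section `sec`
  obtain ⟨J, hJ⟩ := D.exists_isRotationField_projectiveLine
  obtain ⟨ε, hε⟩ := D.exists_isTubeRadius
  obtain ⟨δ₀, hδ₀, hδ₀ε, hw⟩ := helper_wVecNeZeroOfProper 2 m X (ComplexProjectiveSpace 1) D η ε hη hK hε
  have hδ : 0 < δ₀ / 2 := by positivity
  have hδδ₀ : δ₀ / 2 < δ₀ := by linarith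
  have hδε : δ₀ / 2 ≤ ε := by linarith
  obtain ⟨hPc, Rot, hRotc, hOPF, hRotIn, -⟩ :=
    helper_planeFieldRotation 2 m X (ComplexProjectiveSpace 1) D J ε (δ₀ / 2) δ₀ hJ hε hδ hδδ₀ hδ₀ε hw
  obtain ⟨sec, hsecc, hsecP, hSecIn, -⟩ :=
    helper_planeFieldSection 2 m X (ComplexProjectiveSpace 1) D J ε (δ₀ / 2) δ₀ hJ hε hδ hδδ₀ hδ₀ε hw
  have hPcR : ContinuousOn (D.planeField J ε (δ₀ / 2)) (range D.e) := hPc.mono subset_union_left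
  have hRotcR : ContinuousOn Rot (range D.e) := hRotc.mono subset_union_left
  have hOPF' := fun z (hz : z ∈ range D.e) => hOPF z (Or.inl hz)
  -- the disc frame `t` of `P` along the slice `Φ (·, s)` over a disc containing the crossing parameters
  obtain ⟨RS, hRS, hRSZ⟩ : ∃ RS : ℝ, 0 < RS ∧ ∀ ζ ∈ ZK, ‖ζ‖ < RS := by
    refine ⟨(ZK.sup fun ζ => ‖ζ‖₊ : NNReal) + 1, by positivity, fun ζ hζ => ?_⟩
    have h1 : (‖ζ‖₊ : ℝ) ≤ (ZK.sup fun ζ => ‖ζ‖₊ : NNReal) := by exact_mod_cast Finset.le_sup (f := fun ζ => ‖ζ‖₊) hζ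
    rw [coe_nnnorm] at h1
    linarith
  have hcs : Continuous fun z : ℂ => D.e (Φ (z, s)) := D.he.continuous.comp (hΦ.continuous.comp (continuous_id.prodMk continuous_const))
  have hPl : Continuous fun z : ℂ => D.planeField J ε (δ₀ / 2) (D.e (Φ (z, s))) :=
    hPcR.comp_continuous (f := fun z : ℂ => D.e (Φ (z, s))) hcs fun z => ⟨_, rfl⟩
  obtain ⟨w₀, hw₀P, hw₀⟩ : ∃ w₀, D.planeField J ε (δ₀ / 2) (D.e (Φ (0, s))) w₀ = w₀ ∧ w₀ ≠ 0 := by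
    have hne := (hOPF' (D.e (Φ (0, s))) ⟨_, rfl⟩).2.2.2.2.2.2.1
    obtain ⟨w, hw⟩ : ∃ w, D.planeField J ε (δ₀ / 2) (D.e (Φ (0, s))) w ≠ 0 := by
      by_contra h
      push Not at h
      exact hne (ContinuousLinearMap.ext fun w => by rw [h w]; simp)
    exact ⟨_, (hOPF' (D.e (Φ (0, s))) ⟨_, rfl⟩).1 w, hw⟩
  obtain ⟨t, htc, ht⟩ := helper_sectionOverDisc (EuclideanSpace ℝ (Fin m) × EuclideanSpace ℝ (Fin 2))
    (fun z => D.planeField J ε (δ₀ / 2) (D.e (Φ (z, s)))) (RS + 2) w₀ (by positivity) hPl.continuousOn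
    (fun z _ w => (hOPF' (D.e (Φ (z, s))) ⟨_, rfl⟩).1 w) hw₀P hw₀
  have htloc : ∀ ζ ∈ ZK, ∃ ρ : ℝ, 0 < ρ ∧ ContinuousOn t (ball ζ ρ) ∧
      ∀ ζ' ∈ ball ζ ρ, D.planeField J ε (δ₀ / 2) (D.e (Φ (ζ', s))) (t ζ') = t ζ' ∧ t ζ' ≠ 0 := by
    intro ζ hζ
    have hsub : ball ζ 1 ⊆ closedBall (0 : ℂ) (RS + 2) := fun ζ' hζ' => by
      rw [mem_closedBall, dist_zero_right]
      have h1 : ‖ζ'‖ ≤ ‖ζ‖ + dist ζ' ζ := by rw [dist_eq_norm]; exact norm_le_insert' ζ' ζ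
      linarith [hRSZ ζ hζ, (mem_ball.1 hζ').le]
    exact ⟨1, one_pos, htc.mono hsub, fun ζ' hζ' => ht ζ' (hsub hζ')⟩
  -- the coordinate function `φ` of the tautological section in the disc frame
  obtain ⟨φ, hφ⟩ : ∃ φ : ℂ → ℂ, ∀ ζ, φ ζ = ((inner ℝ (sec (D.e (Φ (ζ, s)))).1 (t ζ).1 + inner ℝ (sec (D.e (Φ (ζ, s)))).2 (t ζ).2 : ℝ) : ℂ) +
      ((inner ℝ (sec (D.e (Φ (ζ, s)))).1 (Rot (D.e (Φ (ζ, s))) (t ζ)).1 +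
        inner ℝ (sec (D.e (Φ (ζ, s)))).2 (Rot (D.e (Φ (ζ, s))) (t ζ)).2 : ℝ) : ℂ) * Complex.I := ⟨fun ζ => _, fun ζ => rfl⟩
  -- the local indices at the crossings sum to zero
  obtain ⟨r₁, hr₁, hwind⟩ := helper_nwtIndexSum m X D J ε (δ₀ / 2) Rot sec Φ g UK u o s zc ZK t φ hJ hε hδ hδε hPcR hRotcR
    hOPF' hRotIn hSecIn hΦ hΦd hUK hg hΦU hgΦ hu hbu himm hzc hreg htloc hφ hcount
  -- a radius separating the crossing parameters
  obtain ⟨r, hr, hr1, hrr₁, hsep⟩ : ∃ r : ℝ, 0 < r ∧ r < 1 ∧ r ≤ r₁ ∧ ∀ ζ ∈ ZK, ∀ ζ' ∈ ZK, ζ ≠ ζ' → 2 * r < ‖ζ - ζ'‖ := by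
    obtain ⟨d₀, hd₀, hd⟩ : ∃ d₀ : ℝ, 0 < d₀ ∧ ∀ ζ ∈ ZK, ∀ ζ' ∈ ZK, ζ ≠ ζ' → d₀ ≤ ‖ζ - ζ'‖ := by
      by_cases hne : ((ZK ×ˢ ZK).filter fun p => p.1 ≠ p.2).Nonempty
      · refine ⟨((ZK ×ˢ ZK).filter fun p => p.1 ≠ p.2).inf' hne fun p => ‖p.1 - p.2‖, ?_, fun ζ hζ ζ' hζ' h =>
          Finset.inf'_le (fun p : ℂ × ℂ => ‖p.1 - p.2‖) (Finset.mem_filter.2 ⟨Finset.mk_mem_product hζ hζ', h⟩)⟩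
        obtain ⟨p, hp, hpeq⟩ := Finset.exists_mem_eq_inf' hne fun p => ‖p.1 - p.2‖
        rw [hpeq]
        exact norm_pos_iff.2 (sub_ne_zero.2 (Finset.mem_filter.1 hp).2)
      · exact ⟨1, one_pos, fun ζ hζ ζ' hζ' h => absurd ⟨(ζ, ζ'), Finset.mem_filter.2 ⟨Finset.mk_mem_product hζ hζ', h⟩⟩ hne⟩
    refine ⟨min (min (1 / 2) r₁) (d₀ / 3), by positivity, ?_, (min_le_left _ _).trans (min_le_right _ _), fun ζ hζ ζ' hζ' h => ?_⟩
    · linarith [min_le_left (min (1 / 2) r₁) (d₀ / 3), min_le_left (1 / 2 : ℝ) r₁]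
    · have := hd ζ hζ ζ' hζ' h
      linarith [min_le_right (min (1 / 2) r₁) (d₀ / 3)]
  -- the tautological section of `P|K` off the crossings
  have hGe : Continuous fun θ => D.e (G θ) := D.he.continuous.comp G.continuous
  have hGoff' : ∀ θ, θ ∉ CodimTwoData.linePt 0 '' (↑ZK : Set ℂ) → D.e (G θ) ∈ (range D.e \ D.img) ∪ {z | δ₀ / 2 < infDist z D.img} :=
    fun θ hθ => Or.inl ⟨⟨_, rfl⟩, fun h => hGoff θ hθ (himg _ h)⟩
  -- a nowhere-zero section of `P|K`
  obtain ⟨s', hs'c, hs'⟩ := helper_sphereSectionOfIndexZero m (fun θ => D.planeField J ε (δ₀ / 2) (D.e (G θ)))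
    (fun θ => Rot (D.e (G θ))) (fun θ => sec (D.e (G θ))) t φ ZK (RS + 1) (RS + 2) r
    (hPcR.comp_continuous hGe fun θ => ⟨_, rfl⟩) (hRotcR.comp_continuous hGe fun θ => ⟨_, rfl⟩)
    (fun θ => hOPF' _ ⟨_, rfl⟩) (by positivity) (by linarith) hr (fun ζ hζ => by linarith [hRSZ ζ hζ]) hsep
    (hsecc.comp hGe.continuousOn fun θ hθ => hGoff' θ hθ) (fun θ hθ => hsecP _ (hGoff' θ hθ)) htc
    (fun z hz => by simp only [hGΦ]; exact ht z hz) (fun z => by simp only [hGΦ]; exact hφ z) (hwind r hr hrr₁).2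
  -- transport along the homotopy `G ≃ F`
  haveI : TopologicalSpace.MetrizableSpace (ComplexProjectiveSpace 1) := TopologicalSpace.metrizableSpace_of_t3_secondCountable _
  letI : MetricSpace (ComplexProjectiveSpace 1) := TopologicalSpace.metrizableSpaceMetric _
  obtain ⟨Hm⟩ := hGF
  obtain ⟨σ, hσc, hσ⟩ := helper_transportSection (EuclideanSpace ℝ (Fin m) × EuclideanSpace ℝ (Fin 2)) (ComplexProjectiveSpace 1)
    (fun y τ => D.planeField J ε (δ₀ / 2) (D.e (Hm (τ, y)))) s'
    (hPcR.comp_continuous (D.he.continuous.comp (Hm.continuous.comp (continuous_snd.prodMk continuous_fst))) fun p => ⟨_, rfl⟩)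
    (fun y τ w => (hOPF' _ ⟨_, rfl⟩).1 w) hs'c (fun y => by simp only [ContinuousMap.Homotopy.apply_zero]; exact (hs' y).1)
    fun y => (hs' y).2
  -- at `τ = 1` the plane field is the normal projection of `Σ`
  refine ⟨fun y => (σ y).1, continuous_fst.comp hσc, fun y => ?_⟩
  show D.Q y (σ y).1 = (σ y).1 ∧ (σ y).1 ≠ 0
  have h1 : D.planeField J ε (δ₀ / 2) (D.e (Hm (1, y))) (σ y) = σ y := (hσ y).1
  have hP1 : D.planeField J ε (δ₀ / 2) (D.e (Hm (1, y))) = inOp (D.Q y) := by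
    rw [ContinuousMap.Homotopy.apply_one, hFb]; exact CodimTwoData.planeField_f hε hδ y
  rw [hP1, inOp_apply] at h1
  refine ⟨congrArg Prod.fst h1, fun h0 => (hσ y).2 ?_⟩
  rw [← h1, h0, map_zero, Prod.mk_eq_zero]
  exact ⟨rfl, rfl⟩

end Summit.SmoothPoincare4.SmoothPoincare4.Theorems.GromovRecognitionRelEnd.CrossCapLaurent

end
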